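import Summits.ValiantsHypothesis.ValiantsHypothesis.Theorems.KPlusLogSqLawTropicalBTowerRowTwoGenChain

/-!
# The general `m = 2` tower design — OFF-CHAIN IDENTITY TERMS lie strictly above a chord of the chain

Crux `TropicalB` (stmt-ValiantsHypothesis-19771) calibration, companion of the symmetric tower design `…TowerGraftTowerRowTwoSym`
(`3K − 4`, crux `WeakLifting` 19561): the tree's exact GENERAL row `T(2, K) = 4K − 7` (`TwoRowFamily.tropRootLawAt_two_iff`, witnessed on the
near-arithmetic support `4K²·l + l²`) is ATTAINED ON EVERY 2-TOWER.  NO stub is claimed; nothing on `TropicalB` in its window, `WeakLifting`,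
`MatrixDescartes` (18050) or `VP ≠ VNP`.  Seat: prover leafhand-val-kpluslogsqlaw-1 g3, `--supports stmt-ValiantsHypothesis-19771`.
Identity terms off the staircase: `(x, y)` with `y ≥ x + 2` (`off_id_up`: the late climb of the `(0,0)`-valuation beats every early chord) and
`x ≥ y + 1` (`off_id_down`: the top step `4^{k2 x}(d_x − d_{x−1})` of the staircase valuation beats every chord below it, by the tower
inequality `2d_{x−1} < d_x`).  Def-free.  [this work]
-/

set_option linter.dupNamespace false
set_option autoImplicit false

namespace Summit.ValiantsHypothesis.ValiantsHypothesis.Theorems.KPlusLogSqLaw.TowerGraft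

open Summit.ValiantsHypothesis.ValiantsHypothesis.Theorems.MatrixDescartes.Negative
open Summit.ValiantsHypothesis.ValiantsHypothesis.Theorems.LacunarySymmetroidMatrixDescartes
open Summit.ValiantsHypothesis.ValiantsHypothesis.Theorems.LacunarySymmetroidMatrixDescartes.TropicalCensus
open Summit.ValiantsHypothesis.ValiantsHypothesis.Theorems.KPlusLogSqLaw.EnvelopeCriterion
open Summit.ValiantsHypothesis.ValiantsHypothesis.Theorems.KPlusLogSqLaw.TwoRowFamily (perm_two)
open Finset

namespace TowerRowTwoGen

open TowerRowTwoSym (dN dN_lt dN_tower dN_le dN_nonneg slope_two)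

variable {K : ℕ}
/-! ## 7. Off-chain present terms lie strictly above a chord -/

section offchain
variable (hK : 3 ≤ K) {d : Fin K → ℕ} (hd : ∀ l l' : Fin K, l < l' → 2 * d l < d l')
include hK hd

omit hK hd in
/-- the packaged chord witness at the chain interval `[Xg j, Xg (j+1)]`. -/
theorem chord_witnessg (q : Equiv.Perm (Fin 2) × (Fin 2 → Fin K)) (j : ℕ) (hj : j + 1 ≤ 4 * K - 7)
    (h1 : Xg K d j ≤ TropicalCensus.slope d q) (h2 : TropicalCensus.slope d q ≤ Xg K d (j + 1))
    (h3 : Cg K d j + 4 ^ (j + 1) * (TropicalCensus.slope d q - Xg K d j) < ∑ i, vg K d (q.1 i) i (q.2 i)) :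
    ∃ j : Fin (4 * K - 7), (fun k : Fin (4 * K - 7 + 1) => Xg K d k) j.castSucc ≤ TropicalCensus.slope d q ∧
      TropicalCensus.slope d q ≤ (fun k : Fin (4 * K - 7 + 1) => Xg K d k) j.succ ∧
      (fun k : Fin (4 * K - 7 + 1) => Cg K d k) j.castSucc +
        (fun k : Fin (4 * K - 7 + 1) => (4 : ℤ) ^ (k : ℕ)) j.succ *
          (TropicalCensus.slope d q - (fun k : Fin (4 * K - 7 + 1) => Xg K d k) j.castSucc) <
        ∑ i, vg K d (q.1 i) i (q.2 i) :=
  ⟨⟨j, by omega⟩, h1, h2, h3⟩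

/-- identity terms above the staircase: classes `(x, y)` with `y ≥ x + 2`. -/
theorem off_id_up (x y : ℕ) (hxy : x + 2 ≤ y) (hyK : y + 1 ≤ K)
    (q : Equiv.Perm (Fin 2) × (Fin 2 → Fin K)) (hq : q.1 = 1) (hq0 : ((q.2 0 : Fin K) : ℕ) = x)
    (hq1 : ((q.2 1 : Fin K) : ℕ) = y) :
    ∃ j : Fin (4 * K - 7), (fun k : Fin (4 * K - 7 + 1) => Xg K d k) j.castSucc ≤ TropicalCensus.slope d q ∧
      TropicalCensus.slope d q ≤ (fun k : Fin (4 * K - 7 + 1) => Xg K d k) j.succ ∧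
      (fun k : Fin (4 * K - 7 + 1) => Cg K d k) j.castSucc +
        (fun k : Fin (4 * K - 7 + 1) => (4 : ℤ) ^ (k : ℕ)) j.succ *
          (TropicalCensus.slope d q - (fun k : Fin (4 * K - 7 + 1) => Xg K d k) j.castSucc) <
        ∑ i, vg K d (q.1 i) i (q.2 i) := by
  have hs : TropicalCensus.slope d q = dN K d x + dN K d y := by rw [TowerRowTwoSym.slope_two, hq0, hq1]
  have hc : ∑ i, vg K d (q.1 i) i (q.2 i) = aG K d x + cG K d y := by rw [costg_id d q hq, hq0, hq1]
  have hx0 : 0 ≤ dN K d x - dN K d 0 := by have := dN_le hd (Nat.zero_le x) (by omega); linarith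
  by_cases hyt : y + 1 = K
  · -- y = K − 1: the twin of the chain transposition term (x, K−1), x ≤ K − 3; interval j = 3K−6+x, left endpoint
    have hxK : x + 3 ≤ K := by omega
    have hsX : TropicalCensus.slope d q = Xg K d (3 * K - 6 + x) := by rw [hs, Xlate hK d hxK]; congr 2; omega
    refine chord_witnessg q (3 * K - 6 + x) (by omega) (le_of_eq hsX.symm) ?_ ?_
    · rw [hsX]; exact (Xg_lt_succ hd hK (by omega)).le
    · rw [hsX, sub_self, mul_zero, add_zero, hc, cG_pos d (show y ≠ 0 by omega), show y = K - 1 by omega, k1_top hK,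
        show K - 1 - 1 = K - 2 by omega]
      -- `Cg (3K−6+x) < aG x + Cg(4K−8) − aG (K−2)`
      have hlo := le_Cg_sub hd hK (show 3 * K - 6 + x ≤ 4 * K - 8 by omega) (by omega)
      rw [Xl1 hK, Xlate hK d hxK, show 3 * K - 6 + x + 1 = 3 * K - 5 + x by omega] at hlo
      have hup := aG_sub_le hd hK (show x ≤ K - 2 by omega) (by omega)
      have hpos : 0 < dN K d (K - 2) - dN K d x := by have := dN_lt hd (show x < K - 2 by omega) (by omega); linarith
      have hpow : (4 : ℤ) ^ (3 * (K - 2) - 1) < 4 ^ (3 * K - 5 + x) := pow_lt_pow_right₀ (by norm_num) (by omega)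
      nlinarith [mul_lt_mul_of_pos_right hpow hpos]
  · -- y ≤ K − 2: interval j = 3y − 3 (`[d₀ + d_y, d_{y−1} + d_y]`)
    have hy2 : 2 ≤ y := by omega
    have hyK2 : y + 2 ≤ K := by omega
    refine chord_witnessg q (3 * y - 3) (by omega) ?_ ?_ ?_
    · rw [hs, Xsw d hy2 hyK2]; linarith
    · rw [hs, show 3 * y - 3 + 1 = 3 * y - 2 by omega, Xid1 d (by omega) hyK2]
      have := dN_le hd (show x ≤ y - 1 by omega) (by omega); linarith
    · rw [hs, hc, Xsw d hy2 hyK2, show 3 * y - 3 + 1 = 3 * y - 2 by omega, cG_pos d (show y ≠ 0 by omega),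
        k1_early hyt]
      -- `Cg(3y−3) + 4^{3y−2}(d_x − d₀) < aG x + Cg(3y−2) − aG(y−1)`
      have hstep : Cg K d (3 * y - 2) = Cg K d (3 * y - 3) + 4 ^ (3 * y - 2) * (dN K d (y - 1) + dN K d y - (dN K d 0 + dN K d y)) := by
        have := Cg_succ (K := K) (d := d) (3 * y - 3)
        rw [show 3 * y - 3 + 1 = 3 * y - 2 by omega, Xid1 d (by omega) hyK2, Xsw d hy2 hyK2] at this
        exact this
      have hup := aG_sub_le hd hK (show x ≤ y - 1 by omega) (by omega)
      have hpos : 0 < dN K d (y - 1) - dN K d x := by have := dN_lt hd (show x < y - 1 by omega) (by omega); linarith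
      have hpow : (4 : ℤ) ^ (3 * (y - 1) - 1) < 4 ^ (3 * y - 2) := pow_lt_pow_right₀ (by norm_num) (by omega)
      nlinarith [mul_lt_mul_of_pos_right hpow hpos]

/-- identity terms below the staircase: classes `(x, y)` with `x ≥ y + 1`. -/
theorem off_id_down (x y : ℕ) (hxy : y + 1 ≤ x) (hxK : x + 1 ≤ K)
    (q : Equiv.Perm (Fin 2) × (Fin 2 → Fin K)) (hq : q.1 = 1) (hq0 : ((q.2 0 : Fin K) : ℕ) = x)
    (hq1 : ((q.2 1 : Fin K) : ℕ) = y) :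
    ∃ j : Fin (4 * K - 7), (fun k : Fin (4 * K - 7 + 1) => Xg K d k) j.castSucc ≤ TropicalCensus.slope d q ∧
      TropicalCensus.slope d q ≤ (fun k : Fin (4 * K - 7 + 1) => Xg K d k) j.succ ∧
      (fun k : Fin (4 * K - 7 + 1) => Cg K d k) j.castSucc +
        (fun k : Fin (4 * K - 7 + 1) => (4 : ℤ) ^ (k : ℕ)) j.succ *
          (TropicalCensus.slope d q - (fun k : Fin (4 * K - 7 + 1) => Xg K d k) j.castSucc) <
        ∑ i, vg K d (q.1 i) i (q.2 i) := by
  have hs : TropicalCensus.slope d q = dN K d x + dN K d y := by rw [TowerRowTwoSym.slope_two, hq0, hq1]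
  have hc : ∑ i, vg K d (q.1 i) i (q.2 i) = aG K d x + cG K d y := by rw [costg_id d q hq, hq0, hq1]
  have h00 := dN_nonneg (K := K) (d := d) 0
  have hy0 : 0 ≤ dN K d y - dN K d 0 := by have := dN_le hd (Nat.zero_le y) (by omega); linarith
  have htx : 2 * dN K d (x - 1) < dN K d x := dN_tower hd (show x - 1 < x by omega) (by omega)
  have hx1 : 0 < dN K d x - dN K d (x - 1) := by have := dN_lt hd (show x - 1 < x by omega) (by omega); linarith
  have haG := aG_sub_ge hd hK (show y < x by omega) hxK   -- `4^{k2 x}(d_x − d_{x−1}) ≤ aG x − aG y`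
  by_cases hxt : x + 1 = K
  · -- x = K − 1
    have e2 : k2 K x = 4 * K - 7 := by unfold k2; rw [if_pos hxt]
    rw [e2] at haG
    by_cases hyt : y + 2 = K
    · -- y = K − 2: twin of the chain term (K−2, K−1); interval j = 4K−9, right endpoint
      have hsX : TropicalCensus.slope d q = Xg K d (4 * K - 9 + 1) := by
        rw [hs, show 4 * K - 9 + 1 = 4 * K - 8 by omega, Xl1 hK, show x = K - 1 by omega, show y = K - 2 by omega, add_comm]
      refine chord_witnessg q (4 * K - 9) (by omega) ?_ (le_of_eq hsX) ?_
      · rw [hsX]; exact (Xg_lt_succ hd hK (by omega)).le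
      · rw [hsX, ← Cg_succ, hc, show 4 * K - 9 + 1 = 4 * K - 8 by omega, cG_pos d (show y ≠ 0 by omega),
          k1_early (by omega)]
        -- `Cg(4K−8) < aG x + Cg(3y−2) − aG(y−1)`: top step of `aG` against the chain climb from `(K−3,K−2)` to `(K−2,K−1)`
        have haG' := aG_sub_ge hd hK (show y - 1 < x by omega) hxK
        rw [e2] at haG'
        have hup := Cg_sub_le hd hK (show 3 * y - 2 ≤ 4 * K - 8 by omega) (by omega)
        rw [Xl1 hK, Xid1 d (by omega) (by omega)] at hup
        have hpow : (4 : ℤ) ^ (4 * K - 8) < 4 ^ (4 * K - 7) := pow_lt_pow_right₀ (by norm_num) (by omega)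
        have hKm2 : dN K d (K - 2) = dN K d y := by rw [show y = K - 2 by omega]
        have hKm1 : dN K d (K - 1) = dN K d x := by rw [show x = K - 1 by omega]
        have hxm1 : dN K d (x - 1) = dN K d y := by rw [show x - 1 = y by omega]
        rw [hKm2, hKm1] at hup; rw [hxm1] at haG' htx hx1
        have hym1 : dN K d (y - 1) ≤ dN K d y := dN_le hd (by omega) (by omega)
        have hyn : 0 ≤ dN K d (y - 1) := dN_nonneg _
        have h4pos : (0 : ℤ) < 4 ^ (4 * K - 8) := by positivity
        have hlin : dN K d x - dN K d (y - 1) < 4 * (dN K d x - dN K d y) := by linarith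
        have key : 4 ^ (4 * K - 8) * (dN K d x - dN K d (y - 1)) < 4 ^ (4 * K - 7) * (dN K d x - dN K d y) := by
          rw [show 4 * K - 7 = 4 * K - 8 + 1 by omega, pow_succ, mul_assoc]
          exact mul_lt_mul_of_pos_left hlin h4pos
        linarith [key]
    · -- y ≤ K − 3: twin of the chain transposition term (y, K−1); interval j = 3K−6+y, left endpoint
      have hy3 : y + 3 ≤ K := by omega
      have hsX : TropicalCensus.slope d q = Xg K d (3 * K - 6 + y) := by
        rw [hs, Xlate hK d hy3, show x = K - 1 by omega, add_comm]
      refine chord_witnessg q (3 * K - 6 + y) (by omega) (le_of_eq hsX.symm) ?_ ?_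
      · rw [hsX]; exact (Xg_lt_succ hd hK (by omega)).le
      · rw [hsX, sub_self, mul_zero, add_zero, hc]
        -- `Cg(3K−6+y) < aG (K−1) + cG y`
        have hup := Cg_sub_le hd hK (show 0 ≤ 3 * K - 6 + y by omega) (by omega)
        rw [Xlate hK d hy3, X0 hK, Cg_zero, sub_zero] at hup
        have hpow : (4 : ℤ) ^ (3 * K - 6 + y) * 8 ≤ 4 ^ (4 * K - 7) := by
          have h := pow_le_pow_right₀ (show (1 : ℤ) ≤ 4 by norm_num) (show 3 * K - 6 + y + 2 ≤ 4 * K - 7 by omega)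
          have hP : (0 : ℤ) < 4 ^ (3 * K - 6 + y) := by positivity
          rw [pow_add] at h; norm_num at h; linarith
        have hdx : dN K d x ≤ 2 * (dN K d x - dN K d (x - 1)) := by linarith
        have hKm1 : dN K d (K - 1) = dN K d x := by rw [show x = K - 1 by omega]
        rw [hKm1] at hup
        by_cases hy0 : y = 0
        · subst hy0
          rw [cG_zero]
          have ha0 : aG K d 0 = 0 := rfl
          rw [ha0, sub_zero] at haG
          have h4pos : (0 : ℤ) < 4 ^ (3 * K - 6 + 0) := by positivity
          nlinarith [mul_le_mul_of_nonneg_right hpow hx1.le, h00]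
        · rw [cG_pos d hy0, k1_early (by omega)]
          have haG' := aG_sub_ge hd hK (show y - 1 < x by omega) hxK
          rw [e2] at haG'
          have hup2 := Cg_sub_le hd hK (show 3 * y - 2 ≤ 3 * K - 6 + y by omega) (by omega)
          rw [Xlate hK d hy3, Xid1 d (by omega) (by omega), hKm1] at hup2
          have hy1n : 0 ≤ dN K d (y - 1) := dN_nonneg _
          have h4pos : (0 : ℤ) < 4 ^ (3 * K - 6 + y) := by positivity
          nlinarith [mul_le_mul_of_nonneg_right hpow hx1.le]
  · -- x ≤ K − 2
    have hxK2 : x + 2 ≤ K := by omega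
    have e2 : k2 K x = 3 * x - 1 := by unfold k2; rw [if_neg hxt]
    rw [e2] at haG
    by_cases hyx : y + 1 = x
    · -- twin of the staircase term (x−1, x): slope `Xg(3x−2)`, interval j = 3x−3, right endpoint
      have hsX : TropicalCensus.slope d q = Xg K d (3 * x - 3 + 1) := by
        rw [hs, show 3 * x - 3 + 1 = 3 * x - 2 by omega, Xid1 d (by omega) hxK2, show x - 1 = y by omega, add_comm]
      refine chord_witnessg q (3 * x - 3) (by omega) ?_ (le_of_eq hsX) ?_
      · rw [hsX]; exact (Xg_lt_succ hd hK (by omega)).le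
      · rw [hsX, ← Cg_succ, hc, show 3 * x - 3 + 1 = 3 * x - 2 by omega]
        by_cases hy0 : y = 0
        · -- x = 1: `Cg 1 < aG 1`
          subst hy0
          have hx1' : x = 1 := by omega
          subst hx1'
          rw [cG_zero, add_zero]
          have ha0 : aG K d 0 = 0 := rfl
          rw [ha0, sub_zero] at haG
          have hup := Cg_sub_le hd hK (show 0 ≤ 3 * 1 - 2 by omega) (by omega)
          rw [show 3 * 1 - 2 = 1 by norm_num, show (1 : ℕ) = 3 * 1 - 2 by norm_num, Xid1 d le_rfl (by omega), X0 hK,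
            Cg_zero, sub_zero] at hup
          norm_num at hup haG ⊢
          nlinarith
        · rw [cG_pos d hy0, k1_early (by omega)]
          -- `Cg(3x−2) < aG x + Cg(3y−2) − aG(y−1)`, `y = x − 1`
          have haG' := aG_sub_ge hd hK (show y - 1 < x by omega) hxK
          rw [e2] at haG'
          have hup := Cg_sub_le hd hK (show 3 * y - 2 ≤ 3 * x - 2 by omega) (by omega)
          rw [Xid1 d (by omega) hxK2, Xid1 d (by omega) (by omega), show x - 1 = y by omega] at hup
          have hpow : (4 : ℤ) ^ (3 * x - 2) * 4 = 4 ^ (3 * x - 1) := by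
            rw [← pow_succ]; congr 1; omega
          have hym : dN K d (y - 1) ≤ dN K d y := dN_le hd (by omega) (by omega)
          rw [show x - 1 = y by omega] at htx hx1 haG'
          have h4pos : (0 : ℤ) < 4 ^ (3 * x - 2) := by positivity
          have hyn : 0 ≤ dN K d (y - 1) := dN_nonneg _
          have hlin : dN K d x - dN K d (y - 1) < 4 * (dN K d x - dN K d y) := by linarith
          have key : 4 ^ (3 * x - 2) * (dN K d x - dN K d (y - 1)) < 4 ^ (3 * x - 1) * (dN K d x - dN K d y) := by
            rw [← hpow, mul_assoc]
            exact mul_lt_mul_of_pos_left hlin h4pos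
          linarith [key]
    · -- y ≤ x − 2: interval j = 3x − 3 (`[d₀ + d_x, d_{x−1} + d_x]`)
      have hx2 : 2 ≤ x := by omega
      refine chord_witnessg q (3 * x - 3) (by omega) ?_ ?_ ?_
      · rw [hs, Xsw d hx2 hxK2]; linarith
      · rw [hs, show 3 * x - 3 + 1 = 3 * x - 2 by omega, Xid1 d (by omega) hxK2]
        have := dN_le hd (show y ≤ x - 1 by omega) (by omega); linarith
      · rw [hs, hc, Xsw d hx2 hxK2, show 3 * x - 3 + 1 = 3 * x - 2 by omega]
        have hpow1 : (4 : ℤ) ^ (3 * x - 3) * 4 = 4 ^ (3 * x - 2) := by rw [← pow_succ]; congr 1; omega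
        have hpow2 : (4 : ℤ) ^ (3 * x - 2) * 4 = 4 ^ (3 * x - 1) := by rw [← pow_succ]; congr 1; omega
        have h4pos : (0 : ℤ) < 4 ^ (3 * x - 3) := by positivity
        have htx2 : 2 * dN K d (x - 2) < dN K d (x - 1) := dN_tower hd (show x - 2 < x - 1 by omega) (by omega)
        have hyx2 : dN K d y ≤ dN K d (x - 2) := dN_le hd (by omega) (by omega)
        have hxn : 0 ≤ dN K d x := dN_nonneg _
        have hPx : 0 ≤ 4 ^ (3 * x - 3) * dN K d x := mul_nonneg h4pos.le hxn
        -- the late climb dominates: `8·4^{3x−3}·d_x < aG x − aG y'` for every `y' < x`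
        have hclimb : ∀ {y' : ℕ}, y' < x →
            4 ^ (3 * x - 3) * (8 * dN K d x) < aG K d x - aG K d y' := by
          intro y' hy'
          have h := aG_sub_ge hd hK hy' hxK
          rw [e2, ← hpow2, ← hpow1] at h
          have hlin : 8 * dN K d x < 4 * 4 * (dN K d x - dN K d (x - 1)) := by linarith
          have := mul_lt_mul_of_pos_left hlin h4pos
          linarith
        by_cases hy0 : y = 0
        · subst hy0
          rw [cG_zero, add_zero]
          have hup := Cg_sub_le hd hK (show 0 ≤ 3 * x - 3 by omega) (by omega)
          rw [Xsw d hx2 hxK2, X0 hK, Cg_zero, sub_zero] at hup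
          have hlin : dN K d 0 + dN K d x - (dN K d 0 + dN K d 0) ≤ dN K d x := by linarith
          have hup' : Cg K d (3 * x - 3) ≤ 4 ^ (3 * x - 3) * dN K d x :=
            hup.trans (mul_le_mul_of_nonneg_left hlin h4pos.le)
          have hc := hclimb (show 0 < x by omega)
          have ha0 : aG K d 0 = 0 := rfl
          rw [ha0, sub_zero] at hc
          have hzero : dN K d x + dN K d 0 - (dN K d 0 + dN K d x) = 0 := by ring
          rw [hzero, mul_zero, add_zero]
          linarith
        · rw [cG_pos d hy0, k1_early (by omega)]
          have hup := Cg_sub_le hd hK (show 3 * y - 2 ≤ 3 * x - 3 by omega) (by omega)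
          rw [Xsw d hx2 hxK2, Xid1 d (by omega) (by omega)] at hup
          have hy1n : dN K d 0 ≤ dN K d (y - 1) := dN_le hd (Nat.zero_le _) (by omega)
          have hyn : 0 ≤ dN K d y := dN_nonneg _
          have hlin : dN K d 0 + dN K d x - (dN K d (y - 1) + dN K d y) ≤ dN K d x := by linarith
          have hup' : Cg K d (3 * x - 3) - Cg K d (3 * y - 2) ≤ 4 ^ (3 * x - 3) * dN K d x :=
            hup.trans (mul_le_mul_of_nonneg_left hlin h4pos.le)
          have hlin2 : 4 * (dN K d y - dN K d 0) ≤ dN K d x := by linarith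
          have h2 : 4 ^ (3 * x - 2) * (dN K d x + dN K d y - (dN K d 0 + dN K d x)) ≤ 4 ^ (3 * x - 3) * dN K d x := by
            rw [← hpow1, mul_assoc, show dN K d x + dN K d y - (dN K d 0 + dN K d x) = dN K d y - dN K d 0 by ring]
            exact mul_le_mul_of_nonneg_left hlin2 h4pos.le
          have hc := hclimb (show y - 1 < x by omega)
          linarith

end offchain

end TowerRowTwoGen

end Summit.ValiantsHypothesis.ValiantsHypothesis.Theorems.KPlusLogSqLaw.TowerGraft
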